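import Summits.ValiantsHypothesis.ValiantsHypothesis.Theses.FreeSubtorus
import Literature.Computability.AlgebraicComplexity.GrenetEquivariant

/-!
# `FreeSubtorus.SubtorusCovering` (stmt-ValiantsHypothesis-16134): the `per`-specific input is load-bearing

Negative knowledge for the crux (standing disprover, cycle 1, 2026-08-17), inline statement, no new facts:
the same covering bound with `per_n` replaced by `det_n` is FALSE — `A(X) = X` is an affine determinantal
representation of `det_n` of size `n` with exact lifts of the whole row–column torus (`g = diag d`,
`h⁻¹ = diag e`), hence `T_Λ`-equivariant for every `Λ`, and `n < C(n,⌊n/2⌋)` from `n = 5` on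
(`5 < 10`).  So torus-equivariance plus affineness alone force nothing: the proof must use a property
separating `per` from `det` — in the route's line, von zur Gathen regularity `rank B(0) = m - 1`
(`X` is irregular, `X(0) = 0`); this is Landsberg–Ressayre's remark `edc_T(det_m) = m`.
-/

open Literature.Computability.AlgebraicComplexity MvPolynomial Matrix

noncomputable section

namespace Summit.ValiantsHypothesis.Theorems.SubtorusCoveringNegative.DetForm

/-- `A(X) = X` is a `T_Λ`-equivariant affine determinantal representation of `det_n`, for every subtorus
`T_Λ` of the row–column torus (lifts `g = diag d`, `h⁻¹ = diag e`). [cite: LandsbergRessayre2017, §2] -/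
theorem isEquivariantDetRepr_mvPolynomialX (n r : ℕ) (Λ : Fin r → (Fin n ⊕ Fin n) → ℤ) :
    IsEquivariantDetRepr (Subgroup.closure {γ : Matrix.GeneralLinearGroup (Fin n × Fin n) ℂ |
          ∃ d e : Fin n → ℂˣ, (∀ i, (∏ k, (d k) ^ (Λ i (Sum.inl k))) * (∏ l, (e l) ^ (Λ i (Sum.inr l))) = 1) ∧
            (γ : Matrix (Fin n × Fin n) (Fin n × Fin n) ℂ) =
              Matrix.diagonal (fun p => (d p.1 : ℂ) * (e p.2 : ℂ))}) (detPoly (Fin n) ℂ)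
      (Matrix.mvPolynomialX (Fin n) (Fin n) ℂ) := by
  refine IsEquivariantDetRepr.of_generators ⟨fun i j => ?_, rfl⟩ ?_
  · rw [Matrix.mvPolynomialX_apply, totalDegree_X]
  rintro γ ⟨d, e, -, hγ⟩
  refine ⟨Grenet.diagUnit (fun k => (d k : ℂ)) (fun k => (d k).ne_zero),
    (Grenet.diagUnit (fun l => (e l : ℂ)) (fun l => (e l).ne_zero))⁻¹, ?_⟩
  rw [inv_inv, Grenet.val_diagUnit, Grenet.val_diagUnit, Matrix.diagonal_map (map_zero C),
    Matrix.diagonal_map (map_zero C)]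
  refine Matrix.ext fun i j => ?_
  rw [Matrix.linSubstEntries_apply, Matrix.mul_diagonal, Matrix.diagonal_mul, hγ,
    Matrix.mvPolynomialX_apply, Grenet.linSubst_diagonal_X, MvPolynomial.smul_eq_C_mul]
  simp only [map_mul]
  ring

/-- **The `per`-specific input is load-bearing:** `SubtorusCovering` with `det_n` in place of `per_n` is
FALSE — witness `n = 5`, `m = 5`, `r = 0`, `B = X`: `C(5,2) = 10 > 5`. [cite: LandsbergRessayre2017, §2] -/
theorem subtorusCovering_false_for_detPoly :
    ¬ ∀ n : ℕ, 3 ≤ n → ∀ (m r : ℕ) (Λ : Fin r → (Fin n ⊕ Fin n) → ℤ)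
        (B : Matrix (Fin m) (Fin m) (MvPolynomial (Fin n × Fin n) ℂ)),
        (∀ i, (∑ k, Λ i (Sum.inl k)) = 0 ∧ (∑ l, Λ i (Sum.inr l)) = 0) →
        IsEquivariantDetRepr (Subgroup.closure {γ : Matrix.GeneralLinearGroup (Fin n × Fin n) ℂ |
          ∃ d e : Fin n → ℂˣ, (∀ i, (∏ k, (d k) ^ (Λ i (Sum.inl k))) * (∏ l, (e l) ^ (Λ i (Sum.inr l))) = 1) ∧
            (γ : Matrix (Fin n × Fin n) (Fin n × Fin n) ℂ) =
              Matrix.diagonal (fun p => (d p.1 : ℂ) * (e p.2 : ℂ))}) (detPoly (Fin n) ℂ) B →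
        Nat.choose n (n / 2) ≤ m * 2 ^ r := by
  intro h
  have key := h 5 (by norm_num) 5 0 (fun i => Fin.elim0 i) (Matrix.mvPolynomialX (Fin 5) (Fin 5) ℂ)
    (fun i => Fin.elim0 i) (isEquivariantDetRepr_mvPolynomialX 5 0 _)
  simp [Nat.choose] at key

end Summit.ValiantsHypothesis.Theorems.SubtorusCoveringNegative.DetForm

end
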